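import Summits.AtomisticToContinuum.HydrodynamicLimit.Theorems.PolynomialCompression.Negative.ConstantProfiles
import Summits.AtomisticToContinuum.HydrodynamicLimit.Theorems.DiluteSelfConsistency.Negative.Tightness
import Summits.AtomisticToContinuum.HydrodynamicLimit.Theorems.ImplosionDichotomyDiluteSelfConsistencyPdeForm

/-!
# `DiluteSelfConsistency` holds at uniform profiles — the first positive instance of the crux (stmt-3091)

Support lemmas for the crux `ImplosionDichotomy.DiluteSelfConsistency` (stmt-AtomisticToContinuum-3091), line `birth`
(rev c2, `Cruxes/DiluteSelfConsistency/Lines/birth.lean`), landed by the line lead so that the skeleton's Case I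
(`stub_boundedIdealDiluteSmooth`) has its trivially-stable sub-case in the tree and the standing disprover's load-bearing map
(`Theorems/DiluteSelfConsistency/Negative/Quantifiers.lean`: the hypothesis class is INHABITED exactly at homogeneous rest
states, `exists_admissible_restState`) gets its positive counterpart:

* `DiluteSelfConsistencyConstantProfiles.pde_const` — the particle-free form of the crux (`diluteSelfConsistency_iff_pde`)
  at CONSTANT profiles `(a₀, θ₀, u₀) ≡ (c, ϑ, v)`: below the explicit threshold `σ₀ = min σ₁ 1 η (η₁/2)` (`σ₁` the statics
  threshold of `admissible_iff_data`, `η₁` the uniqueness packing of `unique_of_dilute_eos`) EVERY classical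
  hard-sphere-Euler solution on `[0, T)` with the pinned data `(rhoLim (profileOf c) σ, v, ϑ) = (1, v, ϑ)`
  (`rhoLim_const_eq_one`) IS the uniform state on its whole interval of existence (`unique_of_dilute_eos`: uniqueness in
  the WHOLE typed class against the dilute global solution `DenseExcursionUntied.isHardSphereEulerSolution_const`), so
  its packing is `σ³ < η`.
* `DiluteSelfConsistencyConstantProfiles.holdsAt_const` — the crux's inner clause `DiluteSelfConsistencyHoldsAt`
  (`Negative/Tightness.lean`, the crux being `∀ η > 0, ∀ profiles, ∃ σ₀ > 0, DiluteSelfConsistencyHoldsAt …` by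
  `diluteSelfConsistency_iff_holdsAt`) at every level `η > 0` for all uniform profiles: the tie through the given flow
  family pins the data (`admissible_iff_data`, `tendstoHydroFieldsAt_zero_transfer`), then `pde_const`.
* `diluteSelfConsistency_const` — the crux VERBATIM with the profile quantifiers specialised to constants.

The threshold obeys the disprover's ceiling `σ₀³ ≤ 2η/M` (`sigma0_pow_le`, here `M = 1`): `σ₀ ≤ min 1 η`.
prover-line-stmt-AtomisticToContinuum-3091-c2-0 (line `birth`, rev c2).
-/

noncomputable section

namespace Summit.AtomisticToContinuum.HydrodynamicLimit.Theorems

open MeasureTheory Filter Set Topology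
open Literature.MathematicalPhysics.KineticTheory Literature.Analysis.FluidPDE
open Literature.Analysis.FunctionSpaces
open Summit.AtomisticToContinuum.HydrodynamicLimit.Theses.ImplosionDichotomy (DiluteSelfConsistency)

namespace DiluteSelfConsistencyConstantProfiles

open PolynomialCompressionPDE (Flows admissible_iff_data continuous_slices_zero flows_nonempty)
open PolynomialCompressionConstantProfiles (rhoLim_const_eq_one unique_of_dilute_eos)
open DenseExcursionDichotomy (tendstoHydroFieldsAt_zero_transfer)

/-- **UNIFORM DATA STAY UNIFORM, HENCE DILUTE (particle-free form).** For constant activity `c > 0`, temperature `ϑ > 0`,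
velocity `v` and every level `η > 0` there is `σ₀ > 0` such that for `0 < σ < σ₀` every classical hard-sphere-Euler
solution on `[0, T)` with the pinned data `(rhoLim (profileOf c) σ, v, ϑ)` has packing `ρ_t(x)σ³ < η` on `[0, T)`: the
pinned density is `≡ 1` (`rhoLim_const_eq_one`), the uniform state `(1, v, ϑ)` is a global classical solution with packing
`σ³ ≤ η₁/2`, and every classical solution with the same data coincides with it (`unique_of_dilute_eos`). [folklore] -/
theorem pde_const {c ϑ : ℝ} (hc : 0 < c) (hϑ : 0 < ϑ) (v : V3) {η : ℝ} (hη : 0 < η) :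
    ∃ σ₀ : ℝ, 0 < σ₀ ∧ ∀ σ : ℝ, 0 < σ → σ < σ₀ →
      ∀ (T : ℝ) (ρ θ : ℝ → T3 → ℝ) (u : ℝ → T3 → V3), IsHardSphereEulerSolution σ T ρ u θ →
        ρ 0 = rhoLim (profileOf (fun _ : T3 => c) continuous_const fun _ => hc) σ → u 0 = (fun _ => v) →
          θ 0 = (fun _ => ϑ) → ∀ t ∈ Ico 0 T, ∀ x, ρ t x * σ ^ 3 < η := by
  obtain ⟨η₁, hη₁, U⟩ := unique_of_dilute_eos
  obtain ⟨σ₁, hσ₁, -, G⟩ := admissible_iff_data (a₀ := fun _ : T3 => c) (θ₀ := fun _ => ϑ) (u₀ := fun _ => v)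
    continuous_const continuous_const continuous_const (fun _ => hc) (fun _ => hϑ)
  refine ⟨min σ₁ (min 1 (min η (η₁ / 2))), lt_min hσ₁ (lt_min one_pos (lt_min hη (by positivity))), ?_⟩
  intro σ hσ hσlt T ρ θ u hE h1 h2 h3 t ht x
  have hσ₁' : σ < σ₁ := lt_of_lt_of_le hσlt (min_le_left _ _)
  have hσ1 : σ < 1 := lt_of_lt_of_le hσlt ((min_le_right _ _).trans (min_le_left _ _))
  have hση : σ < η := lt_of_lt_of_le hσlt ((min_le_right _ _).trans ((min_le_right _ _).trans (min_le_left _ _)))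
  have hση₁ : σ < η₁ / 2 :=
    lt_of_lt_of_le hσlt ((min_le_right _ _).trans ((min_le_right _ _).trans (min_le_right _ _)))
  have hσ3 : σ ^ 3 ≤ σ := pow_le_of_le_one hσ.le hσ1.le three_ne_zero
  -- the pinned density is `≡ 1`
  obtain ⟨hS, -⟩ := G σ hσ hσ₁'
  have hρ0 : ρ 0 = fun _ => (1 : ℝ) := by
    rw [h1]; funext y; exact rhoLim_const_eq_one hc hS y
  -- the uniform state is a dilute classical solution with the same data; uniqueness in the whole typed class
  have hC := DenseExcursionUntied.isHardSphereEulerSolution_const σ T v one_pos hϑ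
  have hpk : ∀ s ∈ Ico 0 T, ∀ (y : T3), (fun (_ : ℝ) (_ : T3) => (1 : ℝ)) s y * σ ^ 3 ≤ η₁ / 2 :=
    fun s _ y => by simp only [one_mul]; linarith
  obtain ⟨hρt, -, -⟩ := U σ hσ T T (fun _ _ => 1) (fun _ _ => ϑ) (fun _ _ => v) ρ θ u hC hE hpk hρ0.symm h2.symm
    h3.symm t (by rwa [min_self])
  have hx : ρ t x = 1 := congrFun hρt x
  rw [hx, one_mul]
  linarith

/-- **The crux's inner clause holds at uniform profiles.** For constant activity `c > 0`, temperature `ϑ > 0`, velocity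
`v` and every level `η > 0` there is `σ₀ > 0` with `DiluteSelfConsistencyHoldsAt η c ϑ v σ₀`: for `0 < σ < σ₀`, every
classical hard-sphere-Euler solution on `[0, T)` tied at `t = 0` to the local Gibbs laws (through the given flow family,
hence through every family, `tendstoHydroFieldsAt_zero_transfer`) has pinned data (`admissible_iff_data`; `T > 0` from
`t ∈ Ico 0 T`, so the time-`0` slices are continuous), and `pde_const` applies. [folklore] -/
theorem holdsAt_const {c ϑ : ℝ} (hc : 0 < c) (hϑ : 0 < ϑ) (v : V3) {η : ℝ} (hη : 0 < η) :
    ∃ σ₀ : ℝ, 0 < σ₀ ∧ DiluteSelfConsistencyHoldsAt η (fun _ => c) (fun _ => ϑ) (fun _ => v) σ₀ := by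
  obtain ⟨σ₂, hσ₂, H⟩ := pde_const hc hϑ v hη
  obtain ⟨σ₁, hσ₁, -, G⟩ := admissible_iff_data (a₀ := fun _ : T3 => c) (θ₀ := fun _ => ϑ) (u₀ := fun _ => v)
    continuous_const continuous_const continuous_const (fun _ => hc) (fun _ => hϑ)
  refine ⟨min σ₁ σ₂, lt_min hσ₁ hσ₂, fun σ hσ hσlt T ρ θ u hE Φ htie t ht x => ?_⟩
  have hσ₁' : σ < σ₁ := lt_of_lt_of_le hσlt (min_le_left _ _)
  have hσ₂' : σ < σ₂ := lt_of_lt_of_le hσlt (min_le_right _ _)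
  obtain ⟨hρc, huc, hθc⟩ := continuous_slices_zero hE (ht.1.trans_lt ht.2)
  have hall : ∀ Ψ : Flows σ, TendstoHydroFieldsAt (fun N => localGibbsLaw σ (fun _ => c) (fun _ => v) (fun _ => ϑ) N (Ψ N))
      Ψ ρ u θ 0 :=
    fun Ψ => tendstoHydroFieldsAt_zero_transfer Φ Ψ htie
  obtain ⟨-, G'⟩ := G σ hσ hσ₁'
  obtain ⟨h1, h2, h3⟩ := (G' ρ θ u hρc huc hθc).1 hall
  exact H σ hσ hσ₂' T ρ θ u hE h1 h2 h3 t ht x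

end DiluteSelfConsistencyConstantProfiles

/-- **`DiluteSelfConsistency` AT UNIFORM PROFILES (the crux verbatim, profile quantifiers specialised to constants).** For
every level `η > 0`, constant activity `c > 0`, temperature `ϑ > 0` and velocity `v` there is `σ₀ > 0` such that for
`0 < σ < σ₀` every classical hard-sphere-Euler solution on `[0, T)` tied at `t = 0` to the local Gibbs laws of the uniform
profiles keeps packing `ρ_t(x)σ³ < η` on `[0, T) × 𝕋³` — every such solution is the uniform state. [folklore] -/
theorem diluteSelfConsistency_const :
    ∀ η : ℝ, 0 < η → ∀ (c ϑ : ℝ) (v : V3), 0 < c → 0 < ϑ →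
      ∃ σ₀ : ℝ, 0 < σ₀ ∧ ∀ σ : ℝ, 0 < σ → σ < σ₀ →
        ∀ (T : ℝ) (ρ θ : ℝ → T3 → ℝ) (u : ℝ → T3 → V3), IsHardSphereEulerSolution σ T ρ u θ →
          ∀ Φ : (N : ℕ) → HardSphereFlow (Torus.geometry (Fin 3)) (hsDiameter σ N) (N + 1),
            TendstoHydroFieldsAt (fun N => localGibbsLaw σ (fun _ => c) (fun _ => v) (fun _ => ϑ) N (Φ N)) Φ ρ u θ 0 →
              ∀ t ∈ Ico 0 T, ∀ x, ρ t x * σ ^ 3 < η :=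
  fun _ hη _ _ v hc hϑ => DiluteSelfConsistencyConstantProfiles.holdsAt_const hc hϑ v hη

end Summit.AtomisticToContinuum.HydrodynamicLimit.Theorems

end
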